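import Literature.MathematicalPhysics.QuantumFieldTheory.ConstructiveQFTWave0

/-!
# Torus translations of lattice gauge configurations (leaf module)

A LEAF home (it imports only `ConstructiveQFTWave0`, the home of `Site`, `Edge`, `GaugeConfig`)
for the folklore translations of the discrete torus `(ℤ/Lℤ)^d` and of the gauge configurations
on it:

* `TorusTranslation.torusEdgeShift v : Edge d L ≃ Edge d L`, `(x, i) ↦ (x + v, i)`, with the
  `simp` lemmas `torusEdgeShift_apply`, `torusEdgeShift_symm_apply`;
* `TorusTranslation.torusConfigShift v : GaugeConfig d L G ≃ᵐ GaugeConfig d L G`,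
  `(torusConfigShift v U) (x, i) = U (x - v, i)` (`torusConfigShift_apply`), a measurable
  equivalence built from Mathlib's `MeasurableEquiv.arrowCongr'`.

## Why a leaf, and why the sub-namespace `TorusTranslation`

The same five declarations (byte-identical statements and bodies) were first written at the head
of `LatticeGaugeProofs.lean`, as `Literature.MathematicalPhysics.QuantumFieldTheory.torusEdgeShift`
etc.  That module imports the strong-coupling development (`LatticeGauge`, `StrongCouplingActivities`,
hence `Sweep1`) together with its undischarged named facts, so every file that only needs the
torus translation `τ_v` (e.g. `QuasiLocalGaugePerturbation.lean` and the route files over it) was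
dragging that whole cone along.  The gate pins a fully-qualified name to the module that first
declared it while any importer still uses it, so the leaf copies live in the sub-namespace
`TorusTranslation` (the translation action of the torus on edges and configurations); files that
want the short names write `open Literature.MathematicalPhysics.QuantumFieldTheory.TorusTranslation`
(or receive them through an `export TorusTranslation (…)` of a module they import).  The bodies are
definitionally those of `LatticeGaugeProofs.lean`, so `TorusTranslation.torusConfigShift v` and the
older constant agree by `rfl` wherever both are in scope.

Deliberately NOT here: the intertwining with the periodic lift
(`toTorusObservable_comp_configShift`, needs `LGConfig`/`configShift` from `LatticeGauge.lean`) and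
the translation invariance of the Wilson action / Wilson measure (need the group structure and
`plaquetteHolonomy`); both stay in `LatticeGaugeProofs.lean`.

## References

* K. Osterwalder, E. Seiler, *Gauge field theories on a lattice*, Ann. Phys. 110 (1978) 440, §2
  (periodic boundary conditions; translation invariance of the torus theory) — folklore.
-/

noncomputable section

open MeasureTheory

namespace Literature.MathematicalPhysics.QuantumFieldTheory

namespace TorusTranslation

variable {d L : ℕ} {G : Type*}

/-! ### Torus translations -/

/-- Translation of the edges of the discrete torus `(ℤ/Lℤ)^d` by `v`: `(x, i) ↦ (x + v, i)`. [folklore] -/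
def torusEdgeShift (v : Site d L) : Edge d L ≃ Edge d L :=
  (Equiv.addRight v).prodCongr (Equiv.refl (Fin d))

/-- The edge shift acts by translating the base point. [folklore] -/
@[simp] theorem torusEdgeShift_apply (v : Site d L) (e : Edge d L) :
    torusEdgeShift v e = (e.1 + v, e.2) := rfl

/-- The inverse edge shift translates back. [folklore] -/
@[simp] theorem torusEdgeShift_symm_apply (v : Site d L) (e : Edge d L) :
    (torusEdgeShift v).symm e = (e.1 - v, e.2) := by
  simp [torusEdgeShift, Equiv.prodCongr_symm, sub_eq_add_neg, Prod.map]

section Shift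

variable [MeasurableSpace G]

/-- Translation of torus gauge configurations by `v`: `(torusConfigShift v U) (x, i) = U (x - v, i)`,
as a measurable equivalence (Mathlib `MeasurableEquiv.arrowCongr'`). [folklore] -/
def torusConfigShift (v : Site d L) : GaugeConfig d L G ≃ᵐ GaugeConfig d L G :=
  MeasurableEquiv.arrowCongr' (torusEdgeShift v) (MeasurableEquiv.refl G)

/-- The configuration shift evaluates at the shifted edge. [folklore] -/
@[simp] theorem torusConfigShift_apply (v : Site d L) (U : GaugeConfig d L G) (e : Edge d L) :
    torusConfigShift v U e = U (e.1 - v, e.2) := by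
  change U ((torusEdgeShift v).symm e) = _
  rw [torusEdgeShift_symm_apply]

end Shift

end TorusTranslation

end Literature.MathematicalPhysics.QuantumFieldTheory
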